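import Literature.NumberTheory.LFunctions.WeilTwoPrimeOddMarginHBase
import Literature.NumberTheory.LFunctions.WeilTwoPrimeOddMarginHDataP22
import Literature.NumberTheory.LFunctions.WeilBlockRowsP
import HarnessLib

/-!
# Two-prime odd-margin certificate H: the materialized block agrees with `P_r`, rows 80–89

`WeilCert.checkPmRow` (row `k` of the claim `Pm_{kl} = P_r(2k+1, 2l+1)`) for certificate H, by `decide +kernel`. Pure proof file; nothing is asserted.
-/

noncomputable section

namespace Literature.NumberTheory.LFunctions

set_option maxHeartbeats 0 in
/-- Row 80 of the materialized block is row 80 of `P_r` (certificate H). [folklore] -/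
theorem checkPmRow1_80_weilCert23H : weilCert23HBase.checkPmRow weilCert23HNu weilCert23HPm 1 80 = true := by
  decide +kernel

set_option maxHeartbeats 0 in
/-- Row 81 of the materialized block is row 81 of `P_r` (certificate H). [folklore] -/
theorem checkPmRow1_81_weilCert23H : weilCert23HBase.checkPmRow weilCert23HNu weilCert23HPm 1 81 = true := by
  decide +kernel

set_option maxHeartbeats 0 in
/-- Row 82 of the materialized block is row 82 of `P_r` (certificate H). [folklore] -/
theorem checkPmRow1_82_weilCert23H : weilCert23HBase.checkPmRow weilCert23HNu weilCert23HPm 1 82 = true := by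
  decide +kernel

set_option maxHeartbeats 0 in
/-- Row 83 of the materialized block is row 83 of `P_r` (certificate H). [folklore] -/
theorem checkPmRow1_83_weilCert23H : weilCert23HBase.checkPmRow weilCert23HNu weilCert23HPm 1 83 = true := by
  decide +kernel

set_option maxHeartbeats 0 in
/-- Row 84 of the materialized block is row 84 of `P_r` (certificate H). [folklore] -/
theorem checkPmRow1_84_weilCert23H : weilCert23HBase.checkPmRow weilCert23HNu weilCert23HPm 1 84 = true := by
  decide +kernel

set_option maxHeartbeats 0 in
/-- Row 85 of the materialized block is row 85 of `P_r` (certificate H). [folklore] -/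
theorem checkPmRow1_85_weilCert23H : weilCert23HBase.checkPmRow weilCert23HNu weilCert23HPm 1 85 = true := by
  decide +kernel

set_option maxHeartbeats 0 in
/-- Row 86 of the materialized block is row 86 of `P_r` (certificate H). [folklore] -/
theorem checkPmRow1_86_weilCert23H : weilCert23HBase.checkPmRow weilCert23HNu weilCert23HPm 1 86 = true := by
  decide +kernel

set_option maxHeartbeats 0 in
/-- Row 87 of the materialized block is row 87 of `P_r` (certificate H). [folklore] -/
theorem checkPmRow1_87_weilCert23H : weilCert23HBase.checkPmRow weilCert23HNu weilCert23HPm 1 87 = true := by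
  decide +kernel

set_option maxHeartbeats 0 in
/-- Row 88 of the materialized block is row 88 of `P_r` (certificate H). [folklore] -/
theorem checkPmRow1_88_weilCert23H : weilCert23HBase.checkPmRow weilCert23HNu weilCert23HPm 1 88 = true := by
  decide +kernel

set_option maxHeartbeats 0 in
/-- Row 89 of the materialized block is row 89 of `P_r` (certificate H). [folklore] -/
theorem checkPmRow1_89_weilCert23H : weilCert23HBase.checkPmRow weilCert23HNu weilCert23HPm 1 89 = true := by
  decide +kernel


end Literature.NumberTheory.LFunctions
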